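import Mathlib
import Summits.Ventures.HodgeRepro.Tier4.Common.KTypeSpace
import Summits.Ventures.HodgeRepro.Tier4.Common.SettingOfData
import Summits.Ventures.HodgeRepro.Tier4.Common.PseudoCoeff
import Summits.Ventures.HodgeRepro.Tier4.Line4.MaximalFamilyClosed
import Summits.Ventures.HodgeRepro.Tier4.Line4.ConjSpanLemmas
import Summits.Ventures.HodgeRepro.Tier4.Line4.KTypeTransportGeneric

/-!
# Tier4/Line4/LowestOfPseudoCoeff — C-L4-LOWEST: clauses (5)/(7) of admissibility on a hit constituent from the
pseudo-coefficient display

Blind re-derivation cell `pub-hodge-repro`, Tier 4 «prove the step» (README §9–§10), seat t4-L4-p2 (prover, LINE L4,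
gen 3; plan-4 g3's cut S14352, re-routed to this seat S14416; statements VERBATIM from
proofs/t4-plan-4/work/LowestOfPseudoCoeff-STATEMENTS.lean 958f319c4a8e4697 — only this header replaced). Tree path
`lean/Summits/Ventures/HodgeRepro/Tier4/Line4/LowestOfPseudoCoeff.lean`. Mathlib-level; no literature. Inputs: typer-2's
`Common/PseudoCoeff` (`IsPseudoCoeffAt'`, `IsPseudoCoeffAt`, `not_hasKTypeAt'_of_isPseudoCoeffAt'_of_hit`,
`not_hasKTypeAt_of_isPseudoCoeffAt_of_hit`), L4-p1's `ConjSpanLemmas` (`isIrrNonzero_conj`), `MaximalFamilyClosed`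
(`IsClosedSub`, `isClosedSub_conj`), `KTypeTransportGeneric` (`rightRegular_cj_conj`).

For an adapted ONB `(τ, φ, n)` of `S := Setting.ofAdelicData …` and `C m := conj '' τ m`: (1) a constituent HIT by
`R(f̄₁)` is non-zero, so `C m` is a non-zero irreducible invariant subspace; (2) the hit transports to `C m` as a hit by
`R(cj (cj f₁))` (`rightRegular_cj_conj`); (3)/(4) with `f̄₁` a `T′`- / `T`-pseudo-coefficient at `w₀` and `τ m` closed,
`span ℂ (C m)` has no `T′`- / `T`-type at `w₀` in the window `|(e₊ − e₋) + 2j| < 3` — clauses (7)/(5) of `IsAdmissibleS`,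
which with this seat's `AdmissibleOfONB` (p693090) make the wall's `hadm` exactly «`f̄₁` is a pseudo-coefficient at `w₀`
on both sides» + closedness of the constituents. Junk rows (plan-4 S14352): `τ m = ∅` or `f₁ = 0` make `hhit` false.

Nothing here says anything about the status of the Hodge conjecture for CM abelian varieties, which is NOT proved
(HC_CM is NOT proved by anyone in this repository).
-/

set_option autoImplicit false
noncomputable section
namespace Summit.Ventures.HodgeRepro.Tier4.Line4
open Summit.Ventures.HodgeRepro.Tier4.Common Summit.Ventures.HodgeRepro.Tier4.Line1 MeasureTheory NumberField
open scoped ComplexConjugate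

variable {k : Type} [Field k] [NumberField k] (W : PlaneData k) [MeasurableSpace (GA W)] [BorelSpace (GA W)]
  (R : RTFData W) (μ : Measure (GA W)) [μ.IsHaarMeasure] [R.μT.IsHaarMeasure] [R.μT'.IsHaarMeasure]
  (DG : Set (GA W)) (fdG : IsFundamentalDomain (rationalPoints W) DG μ) (compG : IsCompact (closure DG))
  (compT : IsCompact (closure R.DT)) (compT' : IsCompact (closure R.DT'))

/-- **A hit constituent is non-zero and irreducible, after conjugation** (cut C-L4-LOWEST (1)): `IsIrrNonzero` of
`conj '' τ m` from the adapted ONB and the hit (`isIrrNonzero_conj`; the non-zero vector is the hit one). -/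
theorem isIrrNonzero_conj_of_hit {τ : ℕ → Set (GA W → ℂ)} {φ : ℕ → GA W → ℂ} {n : ℕ → ℕ}
    (hB : (Setting.ofAdelicData W R μ DG fdG compG compT compT').IsAdaptedONB τ φ n) {m : ℕ} {f₁ : GA W → ℂ}
    (hhit : (Setting.ofAdelicData W R μ DG fdG compG compT compT').Hit (RTF.cj f₁) (τ m)) :
    (Setting.ofAdelicData W R μ DG fdG compG compT compT').IsIrrNonzero
      ((fun ψ : GA W → ℂ => fun x => conj (ψ x)) '' τ m) := by
  set S := Setting.ofAdelicData W R μ DG fdG compG compT compT' with hS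
  refine isIrrNonzero_conj S ⟨hB.inv m, hB.irred m, ?_⟩
  obtain ⟨ψ, hψ, x, hx⟩ := hhit
  refine ⟨ψ, hψ, ?_⟩
  by_contra hzero
  apply hx
  have hψ0 : ψ = fun _ => 0 := funext fun y => by
    by_contra hy
    exact hzero ⟨y, hy⟩
  rw [hψ0]
  simp [RTF.Setting.R]

/-- **The hit transports to the conjugate constituent** (cut C-L4-LOWEST (2)): `R(f̄₁)` does not kill `τ m` ⟹ `R(cj (cj f₁))`
does not kill `conj '' τ m` (`rightRegular_cj_conj`). -/
theorem exists_conj_mem_of_hit {τ : ℕ → Set (GA W → ℂ)} {m : ℕ} {f₁ : GA W → ℂ}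
    (hhit : (Setting.ofAdelicData W R μ DG fdG compG compT compT').Hit (RTF.cj f₁) (τ m)) :
    ∃ ψ ∈ (fun ψ : GA W → ℂ => fun x => conj (ψ x)) '' τ m,
      rightRegular W (Setting.ofAdelicData W R μ DG fdG compG compT compT').μ (RTF.cj (RTF.cj f₁)) ψ ≠ 0 := by
  obtain ⟨φ, hφ, x, hx⟩ := hhit
  refine ⟨fun y => conj (φ y), ⟨φ, hφ, rfl⟩, ?_⟩
  intro h
  apply hx
  have h' : rightRegular W μ (RTF.cj (RTF.cj f₁)) (fun y => conj (φ y)) x = 0 := congrFun h x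
  rw [rightRegular_cj_conj W μ (RTF.cj f₁) φ] at h'
  exact (map_eq_zero (starRingEnd ℂ)).1 h'

/-- **Clause (7) of `IsAdmissibleS` on a hit constituent** (cut C-L4-LOWEST (3)): if `f̄₁` is a `T′`-pseudo-coefficient at
`w₀` and `f̄₁` hits the closed constituent `τ m`, then `span ℂ (conj '' τ m)` has no `T′`-type at `w₀` in the window. -/
theorem not_hasKTypeAt'_span_conj_of_hit {τ : ℕ → Set (GA W → ℂ)} {φ : ℕ → GA W → ℂ} {n : ℕ → ℕ}
    (hB : (Setting.ofAdelicData W R μ DG fdG compG compT compT').IsAdaptedONB τ φ n) {m : ℕ}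
    (hcl : IsClosedSub (Setting.ofAdelicData W R μ DG fdG compG compT compT') (τ m))
    (q : QuadData k) (g g' : Matrix (Fin 4) (Fin 4) k) (w₀ : InfinitePlace k) (eP' eM' : InfinitePlace k → ℤ)
    {f₁ : GA W → ℂ}
    (hpc' : IsPseudoCoeffAt' W (Setting.ofAdelicData W R μ DG fdG compG compT compT') q g g' w₀ eP' eM' (RTF.cj f₁))
    (hhit : (Setting.ofAdelicData W R μ DG fdG compG compT compT').Hit (RTF.cj f₁) (τ m)) :
    ∀ j : ℤ, |(eP' w₀ - eM' w₀) + 2 * j| < 3 →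
      ¬ HasKTypeAt' W q w₀ g g' (eP' w₀ + j) (eM' w₀ - j)
        (Submodule.span ℂ ((fun ψ : GA W → ℂ => fun x => conj (ψ x)) '' τ m)) :=
  not_hasKTypeAt'_of_isPseudoCoeffAt'_of_hit W (Setting.ofAdelicData W R μ DG fdG compG compT compT') q g g' w₀ eP'
    eM' hpc' (isClosedSub_conj _ hcl) (isIrrNonzero_conj_of_hit W R μ DG fdG compG compT compT' hB hhit)
    (exists_conj_mem_of_hit W R μ DG fdG compG compT compT' hhit)

/-- **Clause (5)** (cut C-L4-LOWEST (4)): the `T`-side twin. -/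
theorem not_hasKTypeAt_span_conj_of_hit {τ : ℕ → Set (GA W → ℂ)} {φ : ℕ → GA W → ℂ} {n : ℕ → ℕ}
    (hB : (Setting.ofAdelicData W R μ DG fdG compG compT compT').IsAdaptedONB τ φ n) {m : ℕ}
    (hcl : IsClosedSub (Setting.ofAdelicData W R μ DG fdG compG compT compT') (τ m))
    (q : QuadData k) (w₀ : InfinitePlace k) (eP eM : InfinitePlace k → ℤ) {f₁ : GA W → ℂ}
    (hpc : IsPseudoCoeffAt W (Setting.ofAdelicData W R μ DG fdG compG compT compT') q w₀ eP eM (RTF.cj f₁))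
    (hhit : (Setting.ofAdelicData W R μ DG fdG compG compT compT').Hit (RTF.cj f₁) (τ m)) :
    ∀ j : ℤ, |(eP w₀ - eM w₀) + 2 * j| < 3 →
      ¬ HasKTypeAt W q w₀ (eP w₀ + j) (eM w₀ - j)
        (Submodule.span ℂ ((fun ψ : GA W → ℂ => fun x => conj (ψ x)) '' τ m)) :=
  not_hasKTypeAt_of_isPseudoCoeffAt_of_hit W (Setting.ofAdelicData W R μ DG fdG compG compT compT') q w₀ eP eM hpc
    (isClosedSub_conj _ hcl) (isIrrNonzero_conj_of_hit W R μ DG fdG compG compT compT' hB hhit)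
    (exists_conj_mem_of_hit W R μ DG fdG compG compT compT' hhit)

end Summit.Ventures.HodgeRepro.Tier4.Line4

namespace Summit.Ventures.HodgeRepro.Tier4.Line4
open Summit.Ventures.HodgeRepro.Tier4.Common Summit.Ventures.HodgeRepro.Tier4.Line1 MeasureTheory
variable {k : Type} [Field k] [NumberField k] (W : PlaneData k) [MeasurableSpace (GA W)] [BorelSpace (GA W)]
  (R : RTFData W) (μ : Measure (GA W)) [μ.IsHaarMeasure] [R.μT.IsHaarMeasure] [R.μT'.IsHaarMeasure]
  (DG : Set (GA W)) (fdG : IsFundamentalDomain (rationalPoints W) DG μ) (compG : IsCompact (closure DG))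
  (compT : IsCompact (closure R.DT)) (compT' : IsCompact (closure R.DT'))
example (f ψ : GA W → ℂ) :
    (Setting.ofAdelicData W R μ DG fdG compG compT compT').R f ψ = rightRegular W μ f ψ := rfl
example : (Setting.ofAdelicData W R μ DG fdG compG compT compT').μ = μ := rfl
end Summit.Ventures.HodgeRepro.Tier4.Line4
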